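import Literature.Computability.Cryptography.LWERateGuessTest
import Literature.Computability.Cryptography.LWEPrimePowerSolverData
import Literature.Computability.Cryptography.IIDStatisticalDistance
import Literature.Probability.Distributions.IndepProductLawDistance
import HarnessLib

/-!
# BLPRS 2013, Lemma 2.15: the estimate-and-flag test under perturbed kernels (what finite-precision sampling costs)

Topic `Computability/Cryptography` (LWE), grouping namespace `BLPRS2013`; sequel of `LWERateGuessTest.lean`
(`guessTest K κ U_Y N N' θ`: rows `w < G` of `N` blocks pushed through the kernels `κ w` and tested by `K`,
`N'` self-generated reference blocks `U_Y`, flag a gap `> θ`). A coin-driven machine realises the kernels `κ w`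
and the reference law `U_Y` only up to statistical distance (Gaussian samplers, residues of coin blocks); this
file bounds the price ONCE, at the level of laws (everything PROVED, no definition, no named fact):

* `tvDist_prodLaw_le`, `tvDist_rowBits_le`, `tvDist_guessBits_le`, `tvDist_refBits_le`;
* **`tvDist_guessTest_le`** — `Δ(guessTest K κ U_Y … S, guessTest K κ' U_Y' … S) ≤ G·(N·δ_κ) + N'·δ_U` whenever
  `Δ(κ w x, κ' w x) ≤ δ_κ` for all `w, x` and `Δ(U_Y, U_Y') ≤ δ_U` (`G·N` kernel calls, `N'` reference blocks);
* **`abs_acceptProb_guessTest_sub_le`**, **`abs_acceptProb_flatGuessTest_sub_le`** — the same bound for the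
  acceptance probabilities on ANY input law (the machine's test versus the ideal test of
  `BLPRSRateGuess.lean` / `BLPRSSection4Assembly.lean`).

## References

* Z. Brakerski, A. Langlois, C. Peikert, O. Regev, D. Stehlé, *Classical hardness of learning with errors*, STOC 2013;
  arXiv:1306.0281, Lemma 2.15 with §5 ("one can sample efficiently … to within negligible statistical distance").
  [BrakerskiEtAl2013]
* O. Goldreich, *Foundations of Cryptography I*, CUP 2001, §3.2.2–§3.2.3 (data processing; hybrid argument over
  independent samples). [Goldreich2001]
-/

noncomputable section

open scoped ENNReal
open Literature.Probability.Distributions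

namespace Literature.Computability.Cryptography

namespace BLPRS2013

open LWE LWE.MP12

/-! ### Products and rows -/

/-- **Pairs**: `Δ(p ⊗ r, p' ⊗ r') ≤ Δ(p, p') + Δ(r, r')`. [cite: Goldreich2001, §3.2.3] -/
theorem tvDist_prodLaw_le {α β : Type} (p p' : PMF α) (r r' : PMF β) :
    (prodLaw p r).tvDist (prodLaw p' r') ≤ p.tvDist p' + r.tvDist r' :=
  PMF.tvDist_bind_bind_le p p' _ _ fun _ => PMF.tvDist_map_le_holds _ _ _

section GuessTest

variable {X Y : Type} [Fintype X] [Fintype Y]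
variable (K : Y → PMF Bool) {G : ℕ} (κ κ' : Fin G → X → PMF Y) (UY UY' : PMF Y) (N N' : ℕ) (θ : ℝ)

omit [Fintype X] [Fintype Y] in
/-- **One row**: `N` kernel calls, `Δ ≤ N·δ_κ`. [cite: Goldreich2001, §3.2.3] -/
theorem tvDist_rowBits_le {δκ : ℝ} (hκ : ∀ w x, (κ w x).tvDist (κ' w x) ≤ δκ) (w : Fin G) (Sw : Fin N → X) :
    (rowBits K κ N w Sw).tvDist (rowBits K κ' N w Sw) ≤ N * δκ := by
  unfold rowBits
  refine (tvDist_indepLaw_le N _ _).trans ?_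
  calc ∑ i, ((κ w (Sw i)).bind K).tvDist ((κ' w (Sw i)).bind K) ≤ ∑ _i : Fin N, δκ :=
        Finset.sum_le_sum fun i _ => (PMF.tvDist_bind_left_le _ _ K).trans (hκ w (Sw i))
    _ = N * δκ := by rw [Finset.sum_const, Finset.card_univ, Fintype.card_fin, nsmul_eq_mul]

omit [Fintype X] [Fintype Y] in
/-- **All rows**: `G·N` kernel calls, `Δ ≤ G·(N·δ_κ)`. [cite: Goldreich2001, §3.2.3] -/
theorem tvDist_guessBits_le {δκ : ℝ} (hκ : ∀ w x, (κ w x).tvDist (κ' w x) ≤ δκ) (S : Fin G → Fin N → X) :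
    (guessBits K κ N S).tvDist (guessBits K κ' N S) ≤ G * (N * δκ) := by
  unfold guessBits
  rw [← indepLaw_eq_piLaw, ← indepLaw_eq_piLaw]
  refine (tvDist_indepLaw_le G _ _).trans ?_
  calc ∑ w, (rowBits K κ N w (S w)).tvDist (rowBits K κ' N w (S w)) ≤ ∑ _w : Fin G, (N : ℝ) * δκ :=
        Finset.sum_le_sum fun w _ => tvDist_rowBits_le K κ κ' N hκ w (S w)
    _ = G * (N * δκ) := by rw [Finset.sum_const, Finset.card_univ, Fintype.card_fin, nsmul_eq_mul]

omit [Fintype Y] in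
/-- **The reference bits**: `N'` reference blocks, `Δ ≤ N'·δ_U`. [cite: Goldreich2001, §3.2.3] -/
theorem tvDist_refBits_le {δU : ℝ} (hU : UY.tvDist UY' ≤ δU) :
    (refBits K UY N').tvDist (refBits K UY' N') ≤ N' * δU := by
  unfold refBits
  rw [ansLaw_eq_iidPMF, ansLaw_eq_iidPMF]
  exact (tvDist_iidPMF_le _ _ N').trans
    (mul_le_mul_of_nonneg_left ((PMF.tvDist_bind_left_le _ _ K).trans hU) (Nat.cast_nonneg N'))

omit [Fintype X] [Fintype Y] in
/-- **The test under perturbed kernels and reference law**: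
`Δ(guessTest K κ U_Y, guessTest K κ' U_Y') ≤ G·(N·δ_κ) + N'·δ_U` on every array of blocks.
[cite: BrakerskiEtAl2013, Lemma 2.15 with §5; Goldreich2001, §3.2.2–§3.2.3] -/
theorem tvDist_guessTest_le {δκ δU : ℝ} (hκ : ∀ w x, (κ w x).tvDist (κ' w x) ≤ δκ) (hU : UY.tvDist UY' ≤ δU)
    (S : Fin G → Fin N → X) :
    (guessTest K κ UY N N' θ S).tvDist (guessTest K κ' UY' N N' θ S) ≤ G * (N * δκ) + N' * δU := by
  unfold guessTest
  exact (PMF.tvDist_map_le_holds _ _ _).trans ((tvDist_prodLaw_le _ _ _ _).trans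
    (add_le_add (tvDist_guessBits_le K κ κ' N hκ S) (tvDist_refBits_le K UY UY' N' hU)))

omit [Fintype X] [Fintype Y] in
/-- **Acceptance probabilities move by at most `G·(N·δ_κ) + N'·δ_U`** on any input law. [cite: BrakerskiEtAl2013, Lemma 2.15 with §5] -/
theorem abs_acceptProb_guessTest_sub_le {δκ δU : ℝ} (hκ : ∀ w x, (κ w x).tvDist (κ' w x) ≤ δκ) (hU : UY.tvDist UY' ≤ δU)
    (P : PMF (Fin G → Fin N → X)) :
    |(acceptProb (guessTest K κ UY N N' θ) P).toReal - (acceptProb (guessTest K κ' UY' N N' θ) P).toReal| ≤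
      G * (N * δκ) + N' * δU := by
  unfold acceptProb
  rw [← PMF.toOuterMeasure_apply_singleton (P.bind _) true, ← PMF.toOuterMeasure_apply_singleton (P.bind _) true]
  exact (PMF.abs_toReal_toOuterMeasure_sub_le_tvDist _ _ {true}).trans
    (PMF.tvDist_bind_le_of_forall_le P _ _ fun S => tvDist_guessTest_le K κ κ' UY UY' N N' θ hκ hU S)

end GuessTest

section Flat

variable {X₀ Y : Type}
variable (K : Y → PMF Bool) {G : ℕ} (N u : ℕ) (κ κ' : Fin G → (Fin u → X₀) → PMF Y) (UY UY' : PMF Y) (N' : ℕ) (θ : ℝ)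

/-- **The flat test under perturbed kernels**: the same bound for `flatGuessTest` (the layout is deterministic).
[cite: BrakerskiEtAl2013, Lemma 2.15 with §5] -/
theorem abs_acceptProb_flatGuessTest_sub_le {δκ δU : ℝ} (hκ : ∀ w x, (κ w x).tvDist (κ' w x) ≤ δκ) (hU : UY.tvDist UY' ≤ δU)
    (P : PMF (Fin (G * (N * u)) → X₀)) :
    |(acceptProb (flatGuessTest K N u κ UY N' θ) P).toReal - (acceptProb (flatGuessTest K N u κ' UY' N' θ) P).toReal| ≤
      G * (N * δκ) + N' * δU := by
  have h : ∀ (κ₀ : Fin G → (Fin u → X₀) → PMF Y) (U₀ : PMF Y), acceptProb (flatGuessTest K N u κ₀ U₀ N' θ) P =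
      acceptProb (guessTest K κ₀ U₀ N N' θ) (P.map fun S w => blocksOf N u (blocksOf G (N * u) S w)) := by
    intro κ₀ U₀
    unfold acceptProb
    rw [PMF.bind_map]
    rfl
  rw [h, h]
  exact abs_acceptProb_guessTest_sub_le K κ κ' UY UY' N N' θ hκ hU _

end Flat

end BLPRS2013

end Literature.Computability.Cryptography

end
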